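import Summits.BirchSwinnertonDyer.BirchSwinnertonDyer.Theorems.TeichmullerTwistDescentTwistedPeriodLatticeDichotomy
import Summits.BirchSwinnertonDyer.BirchSwinnertonDyer.Theorems.TeichmullerTwistDescentOrdinaryLowValuationOfSaturation
import Summits.BirchSwinnertonDyer.BirchSwinnertonDyer.Theorems.TeichmullerTwistDescentNeronLatticeTwistPStarOfLowValuation
import HarnessLib

/-!
# Route `TeichmullerTwistDescent`, LINE 11: K `TwistedPeriodLatticeSaturation` (stmt-25368) is EQUIVALENT
# to its parent GE11 `OrdinaryLowValuationOptimalManinUnitGeEleven` (stmt-23885) modulo the displayed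
# cite bundle; what remains open is exactly the registered stub `stub_noCaseOne`

Cell `pub/bsd-wall`, seat `bsd-line-ttd-p1` (g5). THEOREMS ONLY. With `stub_dichotomy` discharged modulo
modularity (`TwistedPeriodLatticeDichotomy.stub_dichotomy_of_modularity`) and the converse
`TwistedPeriodLatticeDichotomy.dvd_c_of_caseOne` (index `p²` forces `p ∣ c(D)`), the registered LINE-11
composition `K ⟸ stub_dichotomy ∧ stub_noCaseOne` leaves exactly ONE open stub, `stub_noCaseOne`
(Edixhoven 1991 §4 "case 1" exclusion — OPEN in print), and that stub is itself equivalent to GE11: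

* `twistedPeriodLatticeSaturation_of_modularity_of_noCaseOne` — K ⟸ `exists_isNewformOf` ∧ `stub_noCaseOne`;
* `ordinaryLowValuationGeEleven_of_facts_of_noCaseOne` — GE11 ⟸ `EdixhovenKodairaAndModularityFacts`
  (stmt-25370) ∧ `stub_noCaseOne`, through the landed NTL (25369) and glue (25371);
* `noCaseOne_of_modularity_of_geEleven` — `stub_noCaseOne` ⟸ `exists_isNewformOf` ∧ GE11 (pointwise);
* `twistedPeriodLatticeSaturation_iff_geEleven` — **K ⟺ GE11 granted the bundle 25370**: LINE 11 is a
  faithful REFORMULATION of Edixhoven's open case in period-lattice language (F″-free, Ihara-free), no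
  weaker and no stronger.
CONDITIONAL results only (the gate records `proof.conditional`); no item is closed by this file. BSD /
W-ALL / Manin's conjecture are not proved by this. [cite: EdixhovenManin1991, Thm. 3 and §4]
-/

set_option autoImplicit false
-- single-conjunct summit: `Summit.BirchSwinnertonDyer.BirchSwinnertonDyer.…` repeats the name by design
set_option linter.dupNamespace false

noncomputable section

open scoped Classical

open WeierstrassCurve Literature.NumberTheory.EllipticCurves Literature.NumberTheory.EllipticCurves.ModularForms
  Literature.NumberTheory.EllipticCurves.Rank1Residual Summit.BirchSwinnertonDyer.Rank1Residual.Additive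
  Summit.BirchSwinnertonDyer.BirchSwinnertonDyer.Theses.TeichmullerTwistDescent

namespace Summit.BirchSwinnertonDyer.BirchSwinnertonDyer.Theorems.TeichmullerTwistDescent

open TwistedPeriodLatticeDichotomy

/-- **K `TwistedPeriodLatticeSaturation` ⟸ Modularity ∧ `stub_noCaseOne`.** The registered LINE-11
composition with `stub_dichotomy` discharged by `stub_dichotomy_of_modularity`: granted `exists_isNewformOf`,
the crux is EXACTLY the exclusion of the index-`p²` member `g(χ)Λ(f ⊗ χ) ⊆ pΛ(f)`. The second hypothesis
is the registered signature of `stub_noCaseOne` verbatim. [cite: EdixhovenManin1991, §4] -/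
theorem twistedPeriodLatticeSaturation_of_modularity_of_noCaseOne (hnf : exists_isNewformOf)
    (hno : ∀ (W : WeierstrassCurve ℚ) [W.IsElliptic] [W.IsGloballyMinimal] (p : ℕ) [Fact p.Prime]
      [NeZero (W.conductorNorm ℤ)] (D : ModularParametrizationData W (W.conductorNorm ℤ))
      (hsq : p ^ 2 ∣ W.conductorNorm ℤ), 11 ≤ p → Rank1Residual.Addv W p → Rank1Residual.Irr W p →
      Summit.BirchSwinnertonDyer.Rank1Residual.Additive.TypeGOrd W p →
      padicValInt p W.minimalDiscriminantInt ≤ 4 →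
      (∀ z ∈ D.L.lattice, ∃ w ∈ periodLattice D.f, z = D.c * w) →
      ∀ (χ : DirichletCharacter ℂ p) (hχ : χ.IsQuadratic), χ.IsPrimitive →
        ¬ (∀ w ∈ periodLattice (charTwist (W.conductorNorm ℤ) (dvd_refl _) hsq hχ D.f),
            ∃ z ∈ periodLattice D.f, gaussSum χ (ZMod.stdAddChar (N := p)) * w = (p : ℂ) * z)) :
    TwistedPeriodLatticeSaturation := by
  intro W _ _ p _ _ D hsq hp11 hadd hirr hGo hV4 hopt χ hχ hprim
  rcases stub_dichotomy_of_modularity hnf W p D hsq hp11 hadd hirr hGo hV4 hopt χ hχ hprim with h | h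
  · exact h
  · exact absurd h (hno W p D hsq hp11 hadd hirr hGo hV4 hopt χ hχ hprim)

/-- **GE11 ⟸ the displayed cite bundle `EdixhovenKodairaAndModularityFacts` (stmt-25370) ∧ `stub_noCaseOne`**
— the F″-free, Ihara-free road of LINE 11 with everything but Edixhoven's "case 1" exclusion discharged:
`twistedPeriodLatticeSaturation_of_modularity_of_noCaseOne` composed with the landed NTL (25369,
`neronLatticeTwistPStarOfLowValuation_proof`) and glue (25371, `ordinaryLowValuationOfSaturation_proof`).
[cite: EdixhovenManin1991, Thm. 3 and §4] -/
theorem ordinaryLowValuationGeEleven_of_facts_of_noCaseOne (hF : EdixhovenKodairaAndModularityFacts)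
    (hno : ∀ (W : WeierstrassCurve ℚ) [W.IsElliptic] [W.IsGloballyMinimal] (p : ℕ) [Fact p.Prime]
      [NeZero (W.conductorNorm ℤ)] (D : ModularParametrizationData W (W.conductorNorm ℤ))
      (hsq : p ^ 2 ∣ W.conductorNorm ℤ), 11 ≤ p → Rank1Residual.Addv W p → Rank1Residual.Irr W p →
      Summit.BirchSwinnertonDyer.Rank1Residual.Additive.TypeGOrd W p →
      padicValInt p W.minimalDiscriminantInt ≤ 4 →
      (∀ z ∈ D.L.lattice, ∃ w ∈ periodLattice D.f, z = D.c * w) →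
      ∀ (χ : DirichletCharacter ℂ p) (hχ : χ.IsQuadratic), χ.IsPrimitive →
        ¬ (∀ w ∈ periodLattice (charTwist (W.conductorNorm ℤ) (dvd_refl _) hsq hχ D.f),
            ∃ z ∈ periodLattice D.f, gaussSum χ (ZMod.stdAddChar (N := p)) * w = (p : ℂ) * z)) :
    OrdinaryLowValuationOptimalManinUnitGeEleven :=
  ordinaryLowValuationOfSaturation_proof (twistedPeriodLatticeSaturation_of_modularity_of_noCaseOne hF.2 hno)
    neronLatticeTwistPStarOfLowValuation_proof hF

/-- **`stub_noCaseOne` ⟸ Modularity ∧ GE11 (pointwise).** If `p ∤ c(D)` for the unstarred optimal datum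
(the GE11 conclusion at `(W, p, D)`), then the index-`p²` member cannot occur at `(W, p, D, χ)`, because it
would force `p ∣ c(D)` (`TwistedPeriodLatticeDichotomy.dvd_c_of_caseOne`). The conclusion is the registered
signature of `stub_noCaseOne` verbatim. [cite: EdixhovenManin1991, §4] -/
theorem noCaseOne_of_modularity_of_geEleven (hnf : exists_isNewformOf)
    (h11 : OrdinaryLowValuationOptimalManinUnitGeEleven) :
    ∀ (W : WeierstrassCurve ℚ) [W.IsElliptic] [W.IsGloballyMinimal] (p : ℕ) [Fact p.Prime]
      [NeZero (W.conductorNorm ℤ)] (D : ModularParametrizationData W (W.conductorNorm ℤ))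
      (hsq : p ^ 2 ∣ W.conductorNorm ℤ), 11 ≤ p → Rank1Residual.Addv W p → Rank1Residual.Irr W p →
      Summit.BirchSwinnertonDyer.Rank1Residual.Additive.TypeGOrd W p →
      padicValInt p W.minimalDiscriminantInt ≤ 4 →
      (∀ z ∈ D.L.lattice, ∃ w ∈ periodLattice D.f, z = D.c * w) →
      ∀ (χ : DirichletCharacter ℂ p) (hχ : χ.IsQuadratic), χ.IsPrimitive →
        ¬ (∀ w ∈ periodLattice (charTwist (W.conductorNorm ℤ) (dvd_refl _) hsq hχ D.f),
            ∃ z ∈ periodLattice D.f, gaussSum χ (ZMod.stdAddChar (N := p)) * w = (p : ℂ) * z) := by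
  intro W _ _ p _ _ D hsq hp11 hadd hirr hGo hV4 hopt χ hχ hprim hcase
  exact h11 W p D hp11 hadd hirr hGo hV4 hopt
    (dvd_c_of_caseOne hnf W p D hsq (by omega) hadd hirr (padicValRat_j_nonneg_of_typeGOrd W p hGo)
      (by omega) hopt χ hχ hprim hcase)

/-- **K ⟺ GE11 granted `EdixhovenKodairaAndModularityFacts` (stmt-25370).** Forward: the landed glue
(25371) with NTL (25369). Backward: GE11 excludes case 1 (`noCaseOne_of_modularity_of_geEleven`), and the
dichotomy modulo modularity leaves only saturation. So the LINE-11 crux K is a faithful reformulation of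
Edixhoven's open case `p ∤ c₀` (potentially good ordinary, Kodaira II/III/IV, `p ≥ 11`, `E[p]` irreducible)
in the language of the period lattices at level `p²M` — a statement with no Néron model, no `F″`, no Ihara
— and is neither weaker nor stronger than GE11. [cite: EdixhovenManin1991, Thm. 3 and §4] -/
theorem twistedPeriodLatticeSaturation_iff_geEleven (hF : EdixhovenKodairaAndModularityFacts) :
    TwistedPeriodLatticeSaturation ↔ OrdinaryLowValuationOptimalManinUnitGeEleven :=
  ⟨fun hK ↦ ordinaryLowValuationOfSaturation_proof hK neronLatticeTwistPStarOfLowValuation_proof hF,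
    fun h11 ↦ twistedPeriodLatticeSaturation_of_modularity_of_noCaseOne hF.2
      (noCaseOne_of_modularity_of_geEleven hF.2 h11)⟩

end Summit.BirchSwinnertonDyer.BirchSwinnertonDyer.Theorems.TeichmullerTwistDescent

end
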